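import Literature.NumberTheory.Transcendental.KZSemialgebraicComplex
import Literature.NumberTheory.Transcendental.KZDirichletScaling

/-!
# `NormalFormPrinciple` (stmt-KontsevichZagierPeriods-3869), line `SketchIdeator1` —
# registered sub-goal `dlogA_scale_mem_relations`: an independent certificate proof

Siege attempt k8 (variation "certificate / decide on the finite core") for the registered stub
`dlogA_scale_mem_relations` of the crux `NormalFormPrinciple` (route HurwitzMicroSectors, leaf
`stub_boxRigidity`, algebraic-pole layer): for real algebraic `s > 0` and `0 < a`, the two dlog
representations `[(a,b), c/y]` and `[(sa,sb), c/y]` of the Kontsevich–Zagier calculus differ by a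
relation.

The proof is ONE explicit change-of-variables certificate (rule (2) of [Kontsevich–Zagier 2001,
§1.2], the generator `KZ.changeOfVariablesRel`), packaged once and for all dimensions as
`of_sub_of_mem_changeOfVariablesRel_of_smul`: for a real ALGEBRAIC `s ≠ 0` the dilation
`Φ y = s • y` of `ℝⁿ` with constant derivative `Φ' = s • id` carries `[r]` to `[r']` whenever
`r'.domain = s • r.domain` and `r.integrand x = r'.integrand (s • x) · |s|ⁿ`; its side conditions
are discharged from the tree's semialgebraic toolkit and Mathlib only —

* `Φ` is `ℚ`-semialgebraic on any `ℚ`-semialgebraic set (coordinatewise: algebraic constant ×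
  coordinate, `isSemialgebraicFunOn_const_of_isAlgebraic`, `IsSemialgebraicFunOn.mul_holds`,
  `IsSemialgebraicMapOn.of_forall`) — `isSemialgebraicMapOn_smul`;
* `HasFDerivWithinAt Φ (s • id)` (`hasFDerivAt_id.const_smul`), `InjOn` (`smul_right_injective`);
* the Jacobian factor is `|det (s • id)| = |s|ⁿ` (`KZ.det_smul_id_fin`, `abs_pow`).

For the stub (`n = 1`): the image of the slab `{a < y < b}` is the slab `{sa < y < sb}`
(`image_smul_slab`), and the remaining **finite core** is the scalar identity
`c / y = (c / (s y)) · s` for `y, s > 0`, decided by `field_simp`.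

No Summits-side import is used (in particular not the lead's `…AlgDlogMoves.lean`, whose
`PiBox.Dlog.dlogA_scale_mem_relations` proves the same registered signature through the
`BetaCancellation` affine-chart helpers): this file is a second, dependency-light proof of the
registered signature, landed `--supports` the crux item.

References: M. Kontsevich, D. Zagier, *Periods* (2001), §1.2 rule (2); J. Bochnak, M. Coste,
M.-F. Roy, *Real Algebraic Geometry* (1998), §2.2. No definitions are introduced.
-/

noncomputable section

open Set
open Literature.NumberTheory.Transcendental Literature.NumberTheory.Transcendental.KZ
open Literature.ModelTheory.ExponentialFields (IsSemialgebraic)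

namespace Summit.KontsevichZagierPeriods.HurwitzMicroSectors.NormalFormPrinciple.DlogAScaleK8

/-- **Image certificate.** For `0 < s` the dilation `y ↦ s • y` of `ℝ¹` maps the coordinate slab
`{a < y₀ < b}` onto the slab `{sa < y₀ < sb}` (the inverse point is `s⁻¹ • x`). [folklore] -/
theorem image_smul_slab {s : ℝ} (hs0 : 0 < s) (a b : ℝ) :
    (fun y : Fin 1 → ℝ => s • y) '' {x | x 0 ∈ Set.Ioo a b} =
      {x : Fin 1 → ℝ | x 0 ∈ Set.Ioo (s * a) (s * b)} := by
  ext x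
  simp only [mem_image, mem_setOf_eq, mem_Ioo]
  constructor
  · rintro ⟨y, ⟨hya, hyb⟩, rfl⟩
    simp only [Pi.smul_apply, smul_eq_mul]
    exact ⟨mul_lt_mul_of_pos_left hya hs0, mul_lt_mul_of_pos_left hyb hs0⟩
  · rintro ⟨hxa, hxb⟩
    refine ⟨s⁻¹ • x, ⟨?_, ?_⟩, smul_inv_smul₀ hs0.ne' x⟩
    · simp only [Pi.smul_apply, smul_eq_mul]
      rw [inv_mul_eq_div, lt_div_iff₀ hs0, mul_comm]
      exact hxa
    · simp only [Pi.smul_apply, smul_eq_mul]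
      rw [inv_mul_eq_div, div_lt_iff₀ hs0, mul_comm]
      exact hxb

/-- **Semialgebraicity certificate.** The dilation `y ↦ s • y` by a real ALGEBRAIC factor `s` is a
`ℚ`-semialgebraic map on every `ℚ`-semialgebraic `σ ⊆ ℝⁿ`: each coordinate is the product of the
algebraic constant `s` (a `ℚ`-semialgebraic function, [Kontsevich–Zagier 2001, §1.1]) with a
coordinate polynomial. [cite: BochnakCosteRoy1998, Prop. 2.2.6] -/
theorem isSemialgebraicMapOn_smul {n : ℕ} {σ : Set (Fin n → ℝ)} (hσ : IsSemialgebraic ℚ σ)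
    {s : ℝ} (hs : IsAlgebraic ℚ s) : IsSemialgebraicMapOn ℚ σ (fun y : Fin n → ℝ => s • y) := by
  refine IsSemialgebraicMapOn.of_forall hσ fun j => ?_
  have hj : IsSemialgebraicFunOn ℚ σ (fun y : Fin n → ℝ => y j) := by
    simpa using isSemialgebraicFunOn_aeval hσ (MvPolynomial.X j : MvPolynomial (Fin n) ℚ)
  exact (IsSemialgebraicFunOn.mul_holds (isSemialgebraicFunOn_const_of_isAlgebraic hσ hs) hj).congr
    fun y _ => by simp only [Pi.mul_apply, Pi.smul_apply, smul_eq_mul]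

/-- **Dilation certificate (rule 2, any dimension).** For a real ALGEBRAIC `s ≠ 0` and two
representations `r, r'` in dimension `n` with `r'.domain = s • r.domain` and
`r.integrand x = r'.integrand (s • x) · |s|ⁿ` on `r.domain`, the difference `[r] − [r']` is ONE
change-of-variables generator: witness `Φ y = s • y`, `Φ' = s • id` (constant), `Φ` is
`ℚ`-semialgebraic (`isSemialgebraicMapOn_smul`), injective (`smul_right_injective`), and
`|det Φ'| = |s|ⁿ` (`KZ.det_smul_id_fin`). [cite: KontsevichZagier2001, §1.2 rule (2)] -/
theorem of_sub_of_mem_changeOfVariablesRel_of_smul {n : ℕ} {s : ℝ} (hs : IsAlgebraic ℚ s)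
    (hs0 : s ≠ 0) (r r' : IntegralRep n)
    (himage : r'.domain = (fun y : Fin n → ℝ => s • y) '' r.domain)
    (hint : ∀ x ∈ r.domain, r.integrand x = r'.integrand (s • x) * |s| ^ n) :
    of r - of r' ∈ changeOfVariablesRel :=
  ⟨n, r, r', fun y => s • y, fun _ => s • ContinuousLinearMap.id ℝ (Fin n → ℝ),
    isSemialgebraicMapOn_smul r.isSemialgebraic_domain hs,
    fun y _ => ((hasFDerivAt_id y).const_smul s).hasFDerivWithinAt,
    fun _ _ _ _ h => smul_right_injective (Fin n → ℝ) hs0 h, himage,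
    fun x hx => by rw [hint x hx, det_smul_id_fin, abs_pow], rfl⟩

/-- **Scaling by an algebraic factor** (rule 2), registered sub-goal `dlogA_scale_mem_relations` of
crux stmt-KontsevichZagierPeriods-3869: for real algebraic `s > 0` and `0 < a`,
`[(a,b), c/y] − [(sa, sb), c/y] ∈ KZ.relations`. Certificate: the dilation `Φ y = s • y`
(`of_sub_of_mem_changeOfVariablesRel_of_smul` at `n = 1`, image `image_smul_slab`), and the finite
core `c / y = (c / (s y)) · s` on the slab (where `y > 0`, `s > 0`), decided by `field_simp`.
[cite: KontsevichZagier2001, §1.2 rule (2)] -/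
theorem dlogA_scale_mem_relations {a b c s : ℝ} (hs : IsAlgebraic ℚ s) (L L' : IntegralRep 1)
    (hd : L.domain = {x | x 0 ∈ Set.Ioo a b})
    (hd' : L'.domain = {x | x 0 ∈ Set.Ioo (s * a) (s * b)})
    (hi : EqOn L.integrand (fun x => c / x 0) L.domain)
    (hi' : EqOn L'.integrand (fun x => c / x 0) L'.domain) (ha0 : 0 < a) (hs0 : 0 < s) :
    of L - of L' ∈ relations := by
  have himage : L'.domain = (fun y : Fin 1 → ℝ => s • y) '' L.domain := by
    rw [hd, hd', image_smul_slab hs0 a b]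
  refine changeOfVariablesRel_subset_relations
    (of_sub_of_mem_changeOfVariablesRel_of_smul hs hs0.ne' L L' himage fun x hx => ?_)
  -- the finite core: `c / x₀ = (c / (s x₀)) · |s| ^ 1` with `x₀ > 0`, `s > 0`
  have hΦx : s • x ∈ L'.domain := himage ▸ mem_image_of_mem _ hx
  have hx0 : 0 < x 0 := by rw [hd] at hx; exact ha0.trans hx.1
  rw [hi hx, hi' hΦx, pow_one, abs_of_pos hs0]
  simp only [Pi.smul_apply, smul_eq_mul]
  field_simp

end Summit.KontsevichZagierPeriods.HurwitzMicroSectors.NormalFormPrinciple.DlogAScaleK8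

end
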